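import Literature.GroupTheory.CombinatorialGroupTheory.PuncturedSurfaceGroupCuspBasesAny
import HarnessLib

/-!
# Free bases for the TWO-NODE-CYCLE shape over an ARBITRARY eliminated cusp (far-cusp bases)

Mochizuki, *Semi-graphs of anabelioids* [SemiAnbd] Example 2.10 p. 31 (the groups `Γ_{g,r}`)
[cite: MochizukiSemiAnbd2006, Ex. 2.10 p.31]; used for [CombGC] Prop. 1.5 (i) p. 12 at the two-component
curve with two nodes (abc-iut-f-164 gen 5, successor row «TWO-NODE-CYCLE·PROP15»).  Companion of
`PuncturedSurfaceGroupTwoNodeCycleBases.lean` (bases `bA` — `c_0` eliminated, `b_m ↦ a_m b_m a_m⁻¹` — and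
`bl` — `c_{r'}` eliminated): the same two vertex groups
`Π_{v₀} ∩ Γ = ⟨a_i, b_i (i<m), c_j (s ≤ j), a_m b_m a_m⁻¹, δ⟩`, `Π_{v₁} ∩ Γ = ⟨a_i, b_i (i>m), c_j (j<s), b_m, δ⟩`
as sub-basis closures of the bases of `PuncturedSurfaceGroupCuspBasesAny.lean` eliminating an ARBITRARY
cusp `c_t` of the OTHER component — so that a far cusp (`c_0` against `Π_{v₀}`, `c_{r'}` against `Π_{v₁}`)
is a letter outside the sub-basis whenever its component carries a second cusp.

* `exists_freeGroupBasis_cycleFirst_elim` — the `c_t`-eliminating basis with `b_m ↦ a_m b_m a_m⁻¹`;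
* `closure_cycleFirst_eq_elim` (`t < s`), `closure_cycleSecond_eq_elim` (`s ≤ t`) — the two closures.
Theorems only; elementary combinatorial group theory.
-/

namespace Literature.GroupTheory.CombinatorialGroupTheory.PuncturedSurfaceGroup

variable {g r' m s : ℕ}

/-- **The `c_t`-eliminating basis with `b_m` replaced by `a_m b_m a_m⁻¹`** (three Nielsen moves, as for
`exists_freeGroupBasis_cycleFirst`). [cite: MochizukiSemiAnbd2006, Ex. 2.10 p.31] -/
theorem exists_freeGroupBasis_cycleFirst_elim (g r' m : ℕ) (hm : m < g) (t : Fin (r' + 1)) :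
    ∃ bA : FreeGroupBasis ((Fin g × Bool) ⊕ Fin r') (PuncturedSurfaceGroup g (r' + 1)),
      (∀ i, bA (Sum.inl (i, false)) = a i) ∧ (∀ i, i ≠ ⟨m, hm⟩ → bA (Sum.inl (i, true)) = b i) ∧
        bA (Sum.inl (⟨m, hm⟩, true)) = a ⟨m, hm⟩ * b ⟨m, hm⟩ * (a ⟨m, hm⟩)⁻¹ ∧
        ∀ z : Fin r', bA (Sum.inr z) = c (t.succAbove z) := by
  classical
  obtain ⟨b₀, ha, hb, hc⟩ := exists_freeGroupBasis_elim g r' t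
  set k : (Fin g × Bool) ⊕ Fin r' := Sum.inl (⟨m, hm⟩, true) with hk
  have hak : ∀ (bb : FreeGroupBasis ((Fin g × Bool) ⊕ Fin r') (PuncturedSurfaceGroup g (r' + 1))),
      bb (Sum.inl (⟨m, hm⟩, false)) = a ⟨m, hm⟩ → a ⟨m, hm⟩ ∈ Subgroup.closure (bb '' {j | j ≠ k}) :=
    fun bb hbb => Subgroup.subset_closure ⟨Sum.inl (⟨m, hm⟩, false), by simp [hk], hbb⟩
  obtain ⟨b₁, hb₁k, hb₁⟩ := exists_freeGroupBasis_update_inv b₀ k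
  obtain ⟨b₂, hb₂k, hb₂⟩ := exists_freeGroupBasis_update_mul_inv b₁ k (a ⟨m, hm⟩)
    (hak b₁ (by rw [hb₁ _ (by simp [hk]), ha]))
  obtain ⟨b₃, hb₃k, hb₃⟩ := exists_freeGroupBasis_update_mul b₂ k (a ⟨m, hm⟩)⁻¹
    (Subgroup.inv_mem _ (hak b₂ (by rw [hb₂ _ (by simp [hk]), hb₁ _ (by simp [hk]), ha])))
  refine ⟨b₃, fun i => ?_, fun i hi => ?_, ?_, fun z => ?_⟩
  · rw [hb₃ _ (by simp [hk]), hb₂ _ (by simp [hk]), hb₁ _ (by simp [hk]), ha]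
  · have hne : (Sum.inl (i, true) : (Fin g × Bool) ⊕ Fin r') ≠ k := by simpa [hk] using hi
    rw [hb₃ _ hne, hb₂ _ hne, hb₁ _ hne, hb]
  · rw [hb₃k, hb₂k, hb₁k, inv_inv]
    change a ⟨m, hm⟩ * b₀ (Sum.inl (⟨m, hm⟩, true)) * (a ⟨m, hm⟩)⁻¹ = _
    rw [hb]
  · rw [hb₃ _ (by simp [hk]), hb₂ _ (by simp [hk]), hb₁ _ (by simp [hk]), hc]

section Closures

variable (hm : m < g) {δ : PuncturedSurfaceGroup g (r' + 1)}
  (hδ : δ = (((List.finRange (r' + 1)).map fun j : Fin (r' + 1) =>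
        if (j : ℕ) < s then c (g := g) j else 1).prod)⁻¹ *
      (((List.finRange g).map fun i : Fin g => if m + 1 ≤ (i : ℕ) then
        a (r := r' + 1) i * b i * (a i)⁻¹ * (b i)⁻¹ else 1).prod)⁻¹ * b ⟨m, hm⟩)

include hδ in
/-- **`Π_{v₀}` of the 2-cycle in a `c_t`-eliminating basis, `t < s`** (a cusp of the OTHER component
eliminated): `⟨a_i, b_i (i<m), c_j (j≥s), a_m b_m a_m⁻¹, δ⟩ = ⟨bA(S)⟩`,
`S = {(i,·) : i<m} ∪ {(m,true)} ∪ {z : s ≤ t.succAbove z}`. [cite: MochizukiSemiAnbd2006, Ex. 2.10 p.31] -/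
theorem closure_cycleFirst_eq_elim (t : Fin (r' + 1)) (ht : (t : ℕ) < s)
    {bA : FreeGroupBasis ((Fin g × Bool) ⊕ Fin r') (PuncturedSurfaceGroup g (r' + 1))}
    (ha : ∀ i, bA (Sum.inl (i, false)) = a i) (hb : ∀ i, i ≠ ⟨m, hm⟩ → bA (Sum.inl (i, true)) = b i)
    (hk : bA (Sum.inl (⟨m, hm⟩, true)) = a ⟨m, hm⟩ * b ⟨m, hm⟩ * (a ⟨m, hm⟩)⁻¹)
    (hc : ∀ z : Fin r', bA (Sum.inr z) = c (t.succAbove z)) :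
    Subgroup.closure {x : PuncturedSurfaceGroup g (r' + 1) |
        (∃ i : Fin g, (i : ℕ) < m ∧ (x = a i ∨ x = b i)) ∨ (∃ j : Fin (r' + 1), s ≤ (j : ℕ) ∧ x = c j) ∨
        x = a ⟨m, hm⟩ * b ⟨m, hm⟩ * (a ⟨m, hm⟩)⁻¹ ∨ x = δ} =
      Subgroup.closure (bA '' {y | Sum.elim (fun p : Fin g × Bool => (p.1 : ℕ) < m ∨ (p.1 = ⟨m, hm⟩ ∧ p.2 = true))
        (fun z : Fin r' => s ≤ ((t.succAbove z : Fin (r' + 1)) : ℕ)) y}) := by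
  classical
  set S_A : Set ((Fin g × Bool) ⊕ Fin r') := {y | Sum.elim (fun p : Fin g × Bool =>
    (p.1 : ℕ) < m ∨ (p.1 = ⟨m, hm⟩ ∧ p.2 = true)) (fun z : Fin r' => s ≤ ((t.succAbove z : Fin (r' + 1)) : ℕ)) y}
    with hS_A
  have haR : ∀ i : Fin g, (i : ℕ) < m → a (r := r' + 1) i ∈ Subgroup.closure (bA '' S_A) := fun i hi =>
    Subgroup.subset_closure ⟨Sum.inl (i, false), Or.inl hi, ha i⟩
  have hbR : ∀ i : Fin g, (i : ℕ) < m → b (r := r' + 1) i ∈ Subgroup.closure (bA '' S_A) := fun i hi =>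
    Subgroup.subset_closure ⟨Sum.inl (i, true), Or.inl hi, hb i (fun h => by subst h; simp at hi)⟩
  have hcR : ∀ j : Fin (r' + 1), s ≤ (j : ℕ) → c (g := g) j ∈ Subgroup.closure (bA '' S_A) := by
    intro j hj
    have hjt : j ≠ t := by rintro rfl; omega
    obtain ⟨z, rfl⟩ := Fin.exists_succAbove_eq hjt
    rw [← hc]
    exact Subgroup.subset_closure ⟨Sum.inr z, by change s ≤ ((t.succAbove z : Fin (r' + 1)) : ℕ); exact hj, rfl⟩
  have hkR : a ⟨m, hm⟩ * b ⟨m, hm⟩ * (a ⟨m, hm⟩)⁻¹ ∈ Subgroup.closure (bA '' S_A) := by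
    rw [← hk]; exact Subgroup.subset_closure ⟨Sum.inl (⟨m, hm⟩, true), Or.inr ⟨rfl, rfl⟩, rfl⟩
  have hδR : δ ∈ Subgroup.closure (bA '' S_A) := by
    rw [nodeLoop₂_eq hm δ hδ]
    exact Subgroup.mul_mem _ (Subgroup.mul_mem _ (prod_map_finRange_ite_mem _ _ _ _ hcR)
      (comm_prod_ite_mem _ _ haR hbR)) hkR
  apply le_antisymm
  · rw [Subgroup.closure_le]
    rintro x (⟨i, hi, rfl | rfl⟩ | ⟨j, hj, rfl⟩ | rfl | rfl)
    · exact haR i hi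
    · exact hbR i hi
    · exact hcR j hj
    · exact hkR
    · exact hδR
  · rw [Subgroup.closure_le]
    rintro _ ⟨y, hy, rfl⟩
    rcases y with ⟨i, _ | _⟩ | z
    · rcases hy with hy | ⟨-, hy⟩
      · rw [ha]; exact Subgroup.subset_closure (Or.inl ⟨i, hy, Or.inl rfl⟩)
      · exact absurd hy (by simp)
    · rcases hy with hy | ⟨rfl, -⟩
      · rw [hb i (fun h => by subst h; simp at hy)]
        exact Subgroup.subset_closure (Or.inl ⟨i, hy, Or.inr rfl⟩)
      · rw [hk]; exact Subgroup.subset_closure (Or.inr (Or.inr (Or.inl rfl)))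
    · rw [hc]
      exact Subgroup.subset_closure (Or.inr (Or.inl ⟨t.succAbove z, hy, rfl⟩))

include hδ in
/-- **`Π_{v₁}` of the 2-cycle in a `c_t`-eliminating basis, `s ≤ t`** (a cusp of the OTHER component
eliminated): `⟨a_i, b_i (i>m), c_j (j<s), b_m, δ⟩ = ⟨bt(S)⟩`,
`S = {(i,·) : m<i} ∪ {(m,true)} ∪ {z : t.succAbove z < s}`. [cite: MochizukiSemiAnbd2006, Ex. 2.10 p.31] -/
theorem closure_cycleSecond_eq_elim (t : Fin (r' + 1)) (ht : s ≤ (t : ℕ))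
    {bt : FreeGroupBasis ((Fin g × Bool) ⊕ Fin r') (PuncturedSurfaceGroup g (r' + 1))}
    (ha : ∀ i, bt (Sum.inl (i, false)) = a i) (hb : ∀ i, bt (Sum.inl (i, true)) = b i)
    (hc : ∀ z : Fin r', bt (Sum.inr z) = c (t.succAbove z)) :
    Subgroup.closure {x : PuncturedSurfaceGroup g (r' + 1) |
        (∃ i : Fin g, m < (i : ℕ) ∧ (x = a i ∨ x = b i)) ∨ (∃ j : Fin (r' + 1), (j : ℕ) < s ∧ x = c j) ∨
        x = b ⟨m, hm⟩ ∨ x = δ} =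
      Subgroup.closure (bt '' {y | Sum.elim (fun p : Fin g × Bool => m < (p.1 : ℕ) ∨ (p.1 = ⟨m, hm⟩ ∧ p.2 = true))
        (fun z : Fin r' => ((t.succAbove z : Fin (r' + 1)) : ℕ) < s) y}) := by
  classical
  set S_B : Set ((Fin g × Bool) ⊕ Fin r') := {y | Sum.elim (fun p : Fin g × Bool =>
    m < (p.1 : ℕ) ∨ (p.1 = ⟨m, hm⟩ ∧ p.2 = true)) (fun z : Fin r' => ((t.succAbove z : Fin (r' + 1)) : ℕ) < s) y}
    with hS_B
  have haR : ∀ i : Fin g, m < (i : ℕ) → a (r := r' + 1) i ∈ Subgroup.closure (bt '' S_B) := fun i hi =>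
    Subgroup.subset_closure ⟨Sum.inl (i, false), Or.inl hi, ha i⟩
  have hbR : ∀ i : Fin g, m < (i : ℕ) → b (r := r' + 1) i ∈ Subgroup.closure (bt '' S_B) := fun i hi =>
    Subgroup.subset_closure ⟨Sum.inl (i, true), Or.inl hi, hb i⟩
  have hcR : ∀ j : Fin (r' + 1), (j : ℕ) < s → c (g := g) j ∈ Subgroup.closure (bt '' S_B) := by
    intro j hj
    have hjt : j ≠ t := by rintro rfl; omega
    obtain ⟨z, rfl⟩ := Fin.exists_succAbove_eq hjt
    rw [← hc]
    exact Subgroup.subset_closure ⟨Sum.inr z, by change ((t.succAbove z : Fin (r' + 1)) : ℕ) < s; exact hj, rfl⟩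
  have hkR : b ⟨m, hm⟩ ∈ Subgroup.closure (bt '' S_B) := by
    rw [← hb]; exact Subgroup.subset_closure ⟨Sum.inl (⟨m, hm⟩, true), Or.inr ⟨rfl, rfl⟩, rfl⟩
  have hδR : δ ∈ Subgroup.closure (bt '' S_B) := by
    rw [hδ]
    refine Subgroup.mul_mem _ (Subgroup.mul_mem _ (Subgroup.inv_mem _ (prod_map_finRange_ite_mem _ _ _ _ hcR))
      (Subgroup.inv_mem _ (comm_prod_ite_mem _ _ (fun i hi => haR i (by omega)) (fun i hi => hbR i (by omega)))))
      hkR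
  apply le_antisymm
  · rw [Subgroup.closure_le]
    rintro x (⟨i, hi, rfl | rfl⟩ | ⟨j, hj, rfl⟩ | rfl | rfl)
    · exact haR i hi
    · exact hbR i hi
    · exact hcR j hj
    · exact hkR
    · exact hδR
  · rw [Subgroup.closure_le]
    rintro _ ⟨y, hy, rfl⟩
    rcases y with ⟨i, _ | _⟩ | z
    · rcases hy with hy | ⟨-, hy⟩
      · rw [ha]; exact Subgroup.subset_closure (Or.inl ⟨i, hy, Or.inl rfl⟩)
      · exact absurd hy (by simp)
    · rcases hy with hy | ⟨rfl, -⟩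
      · rw [hb]; exact Subgroup.subset_closure (Or.inl ⟨i, hy, Or.inr rfl⟩)
      · rw [hb]; exact Subgroup.subset_closure (Or.inr (Or.inr (Or.inl rfl)))
    · rw [hc]
      exact Subgroup.subset_closure (Or.inr (Or.inl ⟨t.succAbove z, hy, rfl⟩))

end Closures

end Literature.GroupTheory.CombinatorialGroupTheory.PuncturedSurfaceGroup
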